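import Mathlib.NumberTheory.LegendreSymbol.QuadraticChar.Basic
import Mathlib.NumberTheory.Primorial
import Mathlib.NumberTheory.PrimeCounting
import Literature.NumberTheory.Sieve.BrunTwinPrimes
import Literature.NumberTheory.EllipticCurves.BinaryQuarticDiscriminantFpCountProofs

/-!
# SoloInformedSquareSieve — an elementary square sieve for the values of a quadratic polynomial

Solo unit `solo-Parity-informed` (ideation tier, informed mode), session 12; `PLAN.md` §19.3(a), CLAIMS C51.

Counting input for `PP_g(x) = o(x)` (`g` quadratic; `SoloInformedQuadraticPrimeCount`): the number of
`n ≤ x` with `g(n)` a perfect square is `o(x/log x)`. Elementary throughout: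
* `card_sq_sub_sq_eq` — in `𝔽_p` (`p` odd), `#{(τ, u) : τ² - u² = Δ} = p - 1` for `Δ ≠ 0`;
* `sum_quadraticChar_sq_sub` — the Jacobsthal sum `∑_τ χ(τ² - Δ) = -1` (`χ` the quadratic character), by
  counting the pairs above through `quadraticChar_card_sqrts`;
* `two_mul_card_sq_sub_eq_mul_sq_le` — `#{τ : ∃ s, τ² - Δ = c s²} ≤ (p + 3)/2` for `Δ, c ≠ 0`;
* `two_mul_card_isSquare_eval_le` — for `g = aX² + bX + c ∈ ℤ[X]` and an odd prime `p ∤ a (b² - 4ac)`: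
  `#{t ∈ 𝔽_p : g(t) is a square in 𝔽_p} ≤ (p + 3)/2` (complete the square);
* `card_filter_range_prod_eq_prod_card`, `card_Icc_filter_forall_le` — Chinese remainder + periodicity
  (after `Literature.NumberTheory.Sieve.BrunTwinPrimes`): `#{1 ≤ n ≤ N : n mod q ∈ Ω_q ∀ q ∈ S} ≤ (N/∏q + 1) ∏ #Ω_q`;
* `card_Icc_filter_eval_eq_sq_le` — for a set `S` of primes `q ≥ 7` not dividing `a (b² - 4ac)`:
  `#{1 ≤ n ≤ N : g(n) is a perfect square} ≤ (5/7)^{#S} (N + ∏_{q ∈ S} q)`;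
* `primeCounting_le_card_goodPrimes_add`, `prod_goodPrimes_le_four_pow` — there are `≥ π(z) - 3 - ω(M)` primes
  `7 ≤ q ≤ z` not dividing `M`, and their product is `≤ 4^z`.
-/

namespace Summit.Parity.BatemanHorn.Theorems

open Finset Polynomial

/-! ### Counting in `𝔽_p` -/

section FiniteField

variable {p : ℕ} [Fact p.Prime]

/-- In `𝔽_p` (`p` odd) the hyperbola `τ² - u² = Δ`, `Δ ≠ 0`, has exactly `p - 1` points:
`v = τ - u` runs over `𝔽_pˣ` and `τ + u = Δ / v`. -/
theorem card_sq_sub_sq_eq (hp2 : p ≠ 2) {Δ : ZMod p} (hΔ : Δ ≠ 0) :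
    #((univ : Finset (ZMod p × ZMod p)).filter fun x => x.1 ^ 2 - x.2 ^ 2 = Δ) = p - 1 := by
  have h2 := Literature.NumberTheory.EllipticCurves.BinaryQuartic.two_ne_zero_zmod hp2
  have hcard : #((univ : Finset (ZMod p)).filter fun v => v ≠ 0) = p - 1 := by
    rw [filter_ne', card_erase_of_mem (mem_univ _), card_univ, ZMod.card]
  rw [← hcard]
  have hv0 : ∀ x : ZMod p × ZMod p, x.1 ^ 2 - x.2 ^ 2 = Δ → x.1 - x.2 ≠ 0 := by
    intro x hx h0
    apply hΔ
    rw [← hx, sq_sub_sq, h0, mul_zero]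
  refine card_nbij' (fun x => x.1 - x.2) (fun v => ((v + Δ * v⁻¹) * 2⁻¹, (Δ * v⁻¹ - v) * 2⁻¹))
    ?_ ?_ ?_ ?_
  · intro x hx
    simp only [mem_coe, mem_filter, mem_univ, true_and] at hx ⊢
    exact hv0 x hx
  · intro v hv
    simp only [mem_coe, mem_filter, mem_univ, true_and] at hv ⊢
    have e : ((v + Δ * v⁻¹) * 2⁻¹) ^ 2 - ((Δ * v⁻¹ - v) * 2⁻¹) ^ 2
        = Δ * (v * v⁻¹) * (2 * 2⁻¹) ^ 2 := by ring
    rw [e, mul_inv_cancel₀ hv, mul_inv_cancel₀ h2]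
    ring
  · intro x hx
    simp only [mem_coe, mem_filter, mem_univ, true_and] at hx
    have hv := hv0 x hx
    have hsum : Δ * (x.1 - x.2)⁻¹ = x.1 + x.2 := by
      rw [eq_comm, eq_mul_inv_iff_mul_eq₀ hv, ← sq_sub_sq, hx]
    refine Prod.ext ?_ ?_
    · show ((x.1 - x.2) + Δ * (x.1 - x.2)⁻¹) * 2⁻¹ = x.1
      rw [hsum]
      have e : ((x.1 - x.2) + (x.1 + x.2)) * 2⁻¹ = x.1 * (2 * 2⁻¹) := by ring
      rw [e, mul_inv_cancel₀ h2, mul_one]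
    · show (Δ * (x.1 - x.2)⁻¹ - (x.1 - x.2)) * 2⁻¹ = x.2
      rw [hsum]
      have e : ((x.1 + x.2) - (x.1 - x.2)) * 2⁻¹ = x.2 * (2 * 2⁻¹) := by ring
      rw [e, mul_inv_cancel₀ h2, mul_one]
  · intro v _
    show (v + Δ * v⁻¹) * 2⁻¹ - (Δ * v⁻¹ - v) * 2⁻¹ = v
    have e : (v + Δ * v⁻¹) * 2⁻¹ - (Δ * v⁻¹ - v) * 2⁻¹ = v * (2 * 2⁻¹) := by ring
    rw [e, mul_inv_cancel₀ h2, mul_one]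

/-- **Jacobsthal sum.** `∑_{τ ∈ 𝔽_p} χ(τ² - Δ) = -1` for `Δ ≠ 0`, `p` odd, `χ` the quadratic character:
count the `p - 1` points of `τ² - u² = Δ` fibrewise, `#{u : u² = w} = χ(w) + 1`. -/
theorem sum_quadraticChar_sq_sub (hp2 : p ≠ 2) {Δ : ZMod p} (hΔ : Δ ≠ 0) :
    ∑ τ : ZMod p, quadraticChar (ZMod p) (τ ^ 2 - Δ) = -1 := by
  have hF : ringChar (ZMod p) ≠ 2 := by rw [ZMod.ringChar_zmod_n]; exact hp2
  have hfib : ∀ τ : ZMod p, (#((univ : Finset (ZMod p)).filter fun u => u ^ 2 = τ ^ 2 - Δ) : ℤ)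
      = quadraticChar (ZMod p) (τ ^ 2 - Δ) + 1 := by
    intro τ
    rw [← quadraticChar_card_sqrts hF (τ ^ 2 - Δ), Set.toFinset_setOf]
  have htot : (#((univ : Finset (ZMod p × ZMod p)).filter fun x => x.1 ^ 2 - x.2 ^ 2 = Δ) : ℤ)
      = ∑ τ : ZMod p, (#((univ : Finset (ZMod p)).filter fun u => u ^ 2 = τ ^ 2 - Δ) : ℤ) := by
    rw [card_filter, ← univ_product_univ, sum_product]
    push_cast
    refine sum_congr rfl fun τ _ => ?_
    rw [card_filter]
    push_cast
    refine sum_congr rfl fun u _ => ?_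
    have e : τ ^ 2 - u ^ 2 = Δ ↔ u ^ 2 = τ ^ 2 - Δ :=
      ⟨fun h => by linear_combination -h, fun h => by linear_combination -h⟩
    simp only [e]
  rw [card_sq_sub_sq_eq hp2 hΔ, Nat.cast_pred (Fact.out : p.Prime).pos] at htot
  simp only [hfib, sum_add_distrib, sum_const, card_univ, ZMod.card, nsmul_eq_mul, mul_one] at htot
  linarith

/-- **Local square count.** For `Δ ≠ 0`, `c ≠ 0` in `𝔽_p` (`p` odd): `#{τ : ∃ s, τ² - Δ = c s²} ≤ (p + 3)/2`.
(`s = 0` gives `≤ 2` values; otherwise `χ(τ² - Δ) = χ(c)`, and by the Jacobsthal sum the two classes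
`χ(τ² - Δ) = ±1` have sizes differing by one.) -/
theorem two_mul_card_sq_sub_eq_mul_sq_le (hp2 : p ≠ 2) {Δ c : ZMod p} (hΔ : Δ ≠ 0) (hc : c ≠ 0) :
    2 * #((univ : Finset (ZMod p)).filter fun τ => ∃ s : ZMod p, τ ^ 2 - Δ = c * s ^ 2) ≤ p + 3 := by
  have hF : ringChar (ZMod p) ≠ 2 := by rw [ZMod.ringChar_zmod_n]; exact hp2
  have hη1 : quadraticChar (ZMod p) c = 1 ∨ quadraticChar (ZMod p) c = -1 := quadraticChar_dichotomy hc
  set Z := (univ : Finset (ZMod p)).filter fun τ => τ ^ 2 - Δ = 0 with hZ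
  set V := (univ : Finset (ZMod p)).filter fun τ => ¬τ ^ 2 - Δ = 0 with hV
  set A := V.filter fun τ => quadraticChar (ZMod p) (τ ^ 2 - Δ) = quadraticChar (ZMod p) c with hA
  set A' := V.filter fun τ => ¬quadraticChar (ZMod p) (τ ^ 2 - Δ) = quadraticChar (ZMod p) c with hA'
  have hZV : #Z + #V = p := by
    rw [hZ, hV, card_filter_add_card_filter_not, card_univ, ZMod.card]
  have hAA' : #A + #A' = #V := by
    rw [hA, hA', card_filter_add_card_filter_not]
  have hZ2 : #Z ≤ 2 := by
    have h1 : (#((univ : Finset (ZMod p)).filter fun x => x ^ 2 = Δ) : ℤ) = quadraticChar (ZMod p) Δ + 1 := by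
      rw [← quadraticChar_card_sqrts hF Δ, Set.toFinset_setOf]
    have hZeq : Z = (univ : Finset (ZMod p)).filter fun x => x ^ 2 = Δ := by
      rw [hZ]
      exact filter_congr fun x _ => sub_eq_zero
    have h2 : quadraticChar (ZMod p) Δ ≤ 1 := by
      rcases quadraticChar_dichotomy hΔ with h | h <;> rw [h]
      norm_num
    have h3 : (#Z : ℤ) ≤ 2 := by rw [hZeq, h1]; linarith
    exact_mod_cast h3
  have hsum := sum_quadraticChar_sq_sub hp2 hΔ
  have hsplit : ∑ τ : ZMod p, quadraticChar (ZMod p) (τ ^ 2 - Δ)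
      = quadraticChar (ZMod p) c * #A - quadraticChar (ZMod p) c * #A' := by
    rw [← sum_filter_add_sum_filter_not univ (fun τ : ZMod p => τ ^ 2 - Δ = 0), ← hZ, ← hV]
    have h0 : ∑ τ ∈ Z, quadraticChar (ZMod p) (τ ^ 2 - Δ) = 0 :=
      sum_eq_zero fun τ hτ => by rw [(mem_filter.mp hτ).2]; exact quadraticChar_zero
    rw [h0, zero_add, ← sum_filter_add_sum_filter_not V
      (fun τ : ZMod p => quadraticChar (ZMod p) (τ ^ 2 - Δ) = quadraticChar (ZMod p) c), ← hA, ← hA']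
    have h1 : ∑ τ ∈ A, quadraticChar (ZMod p) (τ ^ 2 - Δ) = quadraticChar (ZMod p) c * #A := by
      rw [sum_congr rfl fun τ hτ => (mem_filter.mp hτ).2, sum_const, nsmul_eq_mul, mul_comm]
    have h2 : ∑ τ ∈ A', quadraticChar (ZMod p) (τ ^ 2 - Δ) = -quadraticChar (ZMod p) c * #A' := by
      have h2' : ∀ τ ∈ A', quadraticChar (ZMod p) (τ ^ 2 - Δ) = -quadraticChar (ZMod p) c := by
        intro τ hτ
        obtain ⟨hτV, hτη⟩ := mem_filter.mp hτ
        have hne : τ ^ 2 - Δ ≠ 0 := (mem_filter.mp hτV).2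
        rcases quadraticChar_dichotomy hne with h | h <;> rcases hη1 with h' | h' <;> omega
      rw [sum_congr rfl h2', sum_const, nsmul_eq_mul, mul_comm]
    rw [h1, h2]
    ring
  have hAle : (#A : ℤ) ≤ #A' + 1 := by
    rw [hsplit] at hsum
    rcases hη1 with h | h <;> rw [h] at hsum <;> linarith
  have hsub : ((univ : Finset (ZMod p)).filter fun τ => ∃ s : ZMod p, τ ^ 2 - Δ = c * s ^ 2) ⊆ Z ∪ A := by
    intro τ hτ
    obtain ⟨s, hs⟩ := (mem_filter.mp hτ).2
    rw [mem_union]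
    by_cases hs0 : s = 0
    · left
      rw [hZ, mem_filter]
      exact ⟨mem_univ _, by rw [hs, hs0]; ring⟩
    · right
      have hne : τ ^ 2 - Δ ≠ 0 := by rw [hs]; exact mul_ne_zero hc (pow_ne_zero 2 hs0)
      rw [hA, mem_filter, hV, mem_filter]
      refine ⟨⟨mem_univ _, hne⟩, ?_⟩
      rw [hs, map_mul, quadraticChar_sq_one' hs0, mul_one]
  have hle := (card_le_card hsub).trans (card_union_le Z A)
  omega

/-- **Squares among the values of a quadratic polynomial modulo `p`.** For `g ∈ ℤ[X]` of degree `≤ 2`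
with `a = g₂ ≢ 0` and `b² - 4ac ≢ 0 (mod p)`, `p` odd: `#{t ∈ 𝔽_p : g(t) ∈ 𝔽_p²} ≤ (p + 3)/2`
(`4a·g(t) = (2at + b)² - (b² - 4ac)`, and `t ↦ 2at + b` is injective). -/
theorem two_mul_card_isSquare_eval_le (hp2 : p ≠ 2) (g : ℤ[X]) (hdeg : g.natDegree ≤ 2)
    (ha : ((g.coeff 2 : ℤ) : ZMod p) ≠ 0)
    (hD : ((g.coeff 1 ^ 2 - 4 * g.coeff 2 * g.coeff 0 : ℤ) : ZMod p) ≠ 0) :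
    2 * #((univ : Finset (ZMod p)).filter fun t =>
        IsSquare ((g.map (Int.castRingHom (ZMod p))).eval t)) ≤ p + 3 := by
  have h2 := Literature.NumberTheory.EllipticCurves.BinaryQuartic.two_ne_zero_zmod hp2
  have heval : ∀ t : ZMod p, (g.map (Int.castRingHom (ZMod p))).eval t
      = ((g.coeff 2 : ℤ) : ZMod p) * t ^ 2 + ((g.coeff 1 : ℤ) : ZMod p) * t + ((g.coeff 0 : ℤ) : ZMod p) := by
    intro t
    have hdeg' : (g.map (Int.castRingHom (ZMod p))).natDegree < 3 :=
      lt_of_le_of_lt (natDegree_map_le.trans hdeg) (by norm_num)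
    rw [eval_eq_sum_range' hdeg', Finset.sum_range_succ, Finset.sum_range_succ, Finset.sum_range_succ,
      Finset.sum_range_zero]
    simp only [coeff_map, eq_intCast]
    ring
  have hD' : ((g.coeff 1 : ℤ) : ZMod p) ^ 2 - 4 * ((g.coeff 2 : ℤ) : ZMod p) * ((g.coeff 0 : ℤ) : ZMod p) ≠ 0 := by
    convert hD using 1
    push_cast
    ring
  have h4a : 4 * ((g.coeff 2 : ℤ) : ZMod p) ≠ 0 := by
    refine mul_ne_zero ?_ ha
    rw [show (4 : ZMod p) = 2 * 2 by norm_num]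
    exact mul_ne_zero h2 h2
  refine le_trans ?_ (two_mul_card_sq_sub_eq_mul_sq_le hp2 hD' h4a)
  refine Nat.mul_le_mul_left 2 (card_le_card_of_injOn (fun t => 2 * ((g.coeff 2 : ℤ) : ZMod p) * t
    + ((g.coeff 1 : ℤ) : ZMod p)) ?_ ?_)
  · intro t ht
    simp only [mem_coe, mem_filter, mem_univ, true_and] at ht ⊢
    obtain ⟨r, hr⟩ := ht
    rw [heval] at hr
    exact ⟨r, by linear_combination (4 * ((g.coeff 2 : ℤ) : ZMod p)) * hr⟩
  · intro t₁ _ t₂ _ h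
    have h' : (2 * ((g.coeff 2 : ℤ) : ZMod p)) * (t₁ - t₂) = 0 := by linear_combination h
    rcases mul_eq_zero.mp h' with h0 | h0
    · exact absurd h0 (mul_ne_zero h2 ha)
    · exact sub_eq_zero.mp h0

end FiniteField

/-! ### Chinese remainder and periodicity -/

/-- **Chinese remainder count** (cf. `BrunTwinPrimes.card_filter_range_prod_eq_two_pow`): for a finite set `S`
of primes and sets `Ω_q ⊆ 𝔽_q`, the number of residues `a mod ∏ q` with `a mod q ∈ Ω_q` for all `q ∈ S` is
`∏ #Ω_q`. -/
theorem card_filter_range_prod_eq_prod_card (S : Finset ℕ) (hS : ∀ q ∈ S, q.Prime)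
    (Q : (q : ℕ) → ZMod q → Prop) [∀ q, DecidablePred (Q q)] :
    #((range (∏ q ∈ S, q)).filter fun a : ℕ => ∀ q ∈ S, Q q (a : ZMod q))
      = ∏ q ∈ S, #((range q).filter fun t : ℕ => Q q (t : ZMod q)) := by
  classical
  set a : ↥S → ℕ := fun i => (i : ℕ) with ha_def
  have hd : ∏ q ∈ S, q = ∏ i, a i := (Finset.prod_coe_sort S (fun q => q)).symm
  have hcop : Pairwise (Function.onFun Nat.Coprime a) := by
    intro i j hij
    exact (Nat.coprime_primes (hS i i.2) (hS j j.2)).mpr (fun h => hij (Subtype.ext h))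
  haveI hne : ∀ i, NeZero (a i) := fun i => ⟨(hS i i.2).ne_zero⟩
  haveI : NeZero (∏ i, a i) := ⟨Finset.prod_ne_zero_iff.mpr fun i _ => (hne i).ne⟩
  rw [hd]
  set Q' : ZMod (∏ i, a i) → Prop := fun x =>
    ∀ i, Q (a i) (ZMod.castHom (Finset.dvd_prod_of_mem a (Finset.mem_univ i)) (ZMod (a i)) x)
    with hQ'_def
  have hPQ : ∀ n : ℕ, (∀ q ∈ S, Q q (n : ZMod q)) ↔ Q' (n : ZMod (∏ i, a i)) := by
    intro n
    simp only [hQ'_def, map_natCast]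
    constructor
    · intro h i
      exact h i i.2
    · intro h q hq
      exact h ⟨q, hq⟩
  rw [Literature.NumberTheory.Sieve.BrunTwinPrimes.card_filter_range_eq_card_subtype _ Q' hPQ]
  have e1 : {x : ZMod (∏ i, a i) // Q' x} ≃ {y : (∀ i, ZMod (a i)) // ∀ i, Q (a i) (y i)} :=
    (ZMod.prodEquivPi a hcop).toEquiv.subtypeEquiv (fun x => by
      simp only [hQ'_def, RingEquiv.toEquiv_eq_coe, EquivLike.coe_coe, ZMod.prodEquivPi_apply])
  have e2 : {y : (∀ i, ZMod (a i)) // ∀ i, Q (a i) (y i)} ≃ (∀ i, {t : ZMod (a i) // Q (a i) t}) :=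
    Equiv.subtypePiEquivPi (α := ↥S) (β := fun i => ZMod (a i)) (p := fun i (t : ZMod (a i)) => Q (a i) t)
  rw [Fintype.card_congr (e1.trans e2), Fintype.card_pi,
    ← Finset.prod_coe_sort S (fun q => #((range q).filter fun t : ℕ => Q q (t : ZMod q)))]
  refine prod_congr rfl fun i _ => ?_
  exact (Literature.NumberTheory.Sieve.BrunTwinPrimes.card_filter_range_eq_card_subtype
    (fun t : ℕ => Q (a i) (t : ZMod (a i))) (Q (a i)) (fun t => Iff.rfl)).symm

/-- **CRT + periodicity on an interval**: `#{1 ≤ n ≤ N : n mod q ∈ Ω_q ∀ q ∈ S} ≤ (N/∏q + 1) · ∏ #Ω_q`. -/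
theorem card_Icc_filter_forall_le (S : Finset ℕ) (hS : ∀ q ∈ S, q.Prime)
    (Q : (q : ℕ) → ZMod q → Prop) [∀ q, DecidablePred (Q q)] (N : ℕ) :
    (#((Icc 1 N).filter fun n : ℕ => ∀ q ∈ S, Q q (n : ZMod q)) : ℝ)
      ≤ ((N : ℝ) / ((∏ q ∈ S, q : ℕ) : ℝ) + 1)
        * ∏ q ∈ S, (#((range q).filter fun t : ℕ => Q q (t : ZMod q)) : ℝ) := by
  set d := ∏ q ∈ S, q with hd
  have hd0 : 0 < d := Finset.prod_pos fun q hq => (hS q hq).pos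
  have hd0' : (0 : ℝ) < d := by exact_mod_cast hd0
  have hper : Function.Periodic (fun n : ℕ => ∀ q ∈ S, Q q (n : ZMod q)) d := by
    intro n
    have hc : ∀ q ∈ S, ((n + d : ℕ) : ZMod q) = n := fun q hq => by
      rw [Nat.cast_add, (ZMod.natCast_eq_zero_iff d q).mpr (hd ▸ Finset.dvd_prod_of_mem _ hq), add_zero]
    exact propext (forall₂_congr fun q hq => by rw [hc q hq])
  have h := Literature.NumberTheory.Sieve.BrunTwinPrimes.abs_card_filter_Icc_sub_le hd0 _ hper N
  have hc : (Nat.count (fun n : ℕ => ∀ q ∈ S, Q q (n : ZMod q)) d : ℝ)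
      = ∏ q ∈ S, (#((range q).filter fun t : ℕ => Q q (t : ZMod q)) : ℝ) := by
    rw [Nat.count_eq_card_filter_range, hd, card_filter_range_prod_eq_prod_card S hS Q]
    push_cast
    rfl
  rw [hc] at h
  have h' := (abs_le.mp h).2
  have hc0 : (0 : ℝ) ≤ ∏ q ∈ S, (#((range q).filter fun t : ℕ => Q q (t : ZMod q)) : ℝ) :=
    prod_nonneg fun q _ => Nat.cast_nonneg _
  calc (#((Icc 1 N).filter fun n : ℕ => ∀ q ∈ S, Q q (n : ZMod q)) : ℝ)
      ≤ N * (∏ q ∈ S, (#((range q).filter fun t : ℕ => Q q (t : ZMod q)) : ℝ)) / d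
          + ∏ q ∈ S, (#((range q).filter fun t : ℕ => Q q (t : ZMod q)) : ℝ) := by linarith
    _ = ((N : ℝ) / d + 1) * ∏ q ∈ S, (#((range q).filter fun t : ℕ => Q q (t : ZMod q)) : ℝ) := by
        ring

/-! ### The square sieve for `g(n) = m²` -/

/-- **Square sieve.** For `g ∈ ℤ[X]` of degree `≤ 2` and a finite set `S` of primes `q ≥ 7` with
`q ∤ g₂` and `q ∤ g₁² - 4 g₂ g₀`: `#{1 ≤ n ≤ N : g(n) is a square in ℤ} ≤ (5/7)^{#S} (N + ∏_{q ∈ S} q)`. -/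
theorem card_Icc_filter_eval_eq_sq_le (g : ℤ[X]) (hdeg : g.natDegree ≤ 2) (S : Finset ℕ)
    (hS : ∀ q ∈ S, q.Prime ∧ 7 ≤ q ∧ ((g.coeff 2 : ℤ) : ZMod q) ≠ 0 ∧
      ((g.coeff 1 ^ 2 - 4 * g.coeff 2 * g.coeff 0 : ℤ) : ZMod q) ≠ 0) (N : ℕ) :
    (#((Icc 1 N).filter fun n : ℕ => IsSquare (g.eval (n : ℤ))) : ℝ)
      ≤ (5 / 7 : ℝ) ^ #S * (N + ∏ q ∈ S, (q : ℝ)) := by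
  classical
  have hd0 : (0 : ℝ) < ((∏ q ∈ S, q : ℕ) : ℝ) := by
    exact_mod_cast Finset.prod_pos fun q hq => (hS q hq).1.pos
  have h1 : #((Icc 1 N).filter fun n : ℕ => IsSquare (g.eval (n : ℤ)))
      ≤ #((Icc 1 N).filter fun n : ℕ => ∀ q ∈ S,
          IsSquare ((g.map (Int.castRingHom (ZMod q))).eval (n : ZMod q))) := by
    refine card_le_card fun n hn => ?_
    rw [mem_filter] at hn ⊢
    refine ⟨hn.1, fun q _ => ?_⟩
    obtain ⟨m, hm⟩ := hn.2
    exact ⟨(m : ZMod q), by rw [Polynomial.eval_natCast_map, hm, map_mul, eq_intCast]⟩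
  have h2 := card_Icc_filter_forall_le S (fun q hq => (hS q hq).1)
    (fun q (t : ZMod q) => IsSquare ((g.map (Int.castRingHom (ZMod q))).eval t)) N
  have h3 : ∀ q ∈ S, (#((range q).filter fun t : ℕ =>
      IsSquare ((g.map (Int.castRingHom (ZMod q))).eval (t : ZMod q))) : ℝ) ≤ 5 / 7 * q := by
    intro q hq
    obtain ⟨hqp, hq7, ha, hD⟩ := hS q hq
    haveI := Fact.mk hqp
    have h := two_mul_card_isSquare_eval_le (p := q) (by omega) g hdeg ha hD
    have hcard : #((range q).filter fun t : ℕ =>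
          IsSquare ((g.map (Int.castRingHom (ZMod q))).eval (t : ZMod q)))
        = #((univ : Finset (ZMod q)).filter fun t =>
          IsSquare ((g.map (Int.castRingHom (ZMod q))).eval t)) := by
      rw [← Fintype.card_subtype]
      exact Literature.NumberTheory.Sieve.BrunTwinPrimes.card_filter_range_eq_card_subtype _ _
        (fun t => Iff.rfl)
    have h' : (2 : ℝ) * #((range q).filter fun t : ℕ =>
        IsSquare ((g.map (Int.castRingHom (ZMod q))).eval (t : ZMod q))) ≤ q + 3 := by
      rw [hcard]
      exact_mod_cast h
    have hq7' : (7 : ℝ) ≤ q := by exact_mod_cast hq7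
    have goal : (#((range q).filter fun t : ℕ =>
        IsSquare ((g.map (Int.castRingHom (ZMod q))).eval (t : ZMod q))) : ℝ) ≤ 5 / 7 * q := by
      linarith
    convert goal
  calc (#((Icc 1 N).filter fun n : ℕ => IsSquare (g.eval (n : ℤ))) : ℝ)
      ≤ #((Icc 1 N).filter fun n : ℕ => ∀ q ∈ S,
          IsSquare ((g.map (Int.castRingHom (ZMod q))).eval (n : ZMod q))) := by
        exact_mod_cast h1
    _ ≤ ((N : ℝ) / ((∏ q ∈ S, q : ℕ) : ℝ) + 1) * ∏ q ∈ S, (#((range q).filter fun t : ℕ =>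
          IsSquare ((g.map (Int.castRingHom (ZMod q))).eval (t : ZMod q))) : ℝ) := h2
    _ ≤ ((N : ℝ) / ((∏ q ∈ S, q : ℕ) : ℝ) + 1) * ∏ q ∈ S, (5 / 7 * q : ℝ) := by
        gcongr with q hq
        exact h3 q hq
    _ = (5 / 7 : ℝ) ^ #S * (((N : ℝ) / ((∏ q ∈ S, q : ℕ) : ℝ) + 1) * ((∏ q ∈ S, q : ℕ) : ℝ)) := by
        rw [prod_mul_distrib, prod_const]
        push_cast
        ring
    _ = (5 / 7 : ℝ) ^ #S * (N + ∏ q ∈ S, (q : ℝ)) := by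
        rw [add_mul, one_mul, div_mul_cancel₀ _ hd0.ne']
        push_cast
        ring

/-! ### Good primes: how many, and the size of their product -/

/-- The primes `7 ≤ q ≤ z` not dividing `M ≠ 0` number at least `π(z) - 3 - ω(M)`. -/
theorem primeCounting_le_card_goodPrimes_add {M : ℕ} (hM0 : M ≠ 0) (z : ℕ) :
    Nat.primeCounting z ≤ #((range (z + 1)).filter fun q : ℕ => q.Prime ∧ 7 ≤ q ∧ ¬q ∣ M)
      + 3 + #M.primeFactors := by
  have hsub : Nat.primesLE z ⊆ ((range (z + 1)).filter fun q : ℕ => q.Prime ∧ 7 ≤ q ∧ ¬q ∣ M)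
      ∪ (range 7).filter (fun q : ℕ => q.Prime) ∪ (Nat.primesLE z).filter (fun q : ℕ => q ∣ M) := by
    intro q hq
    have hq' := hq
    rw [Nat.primesLE_eq_filter_range, mem_filter, mem_range] at hq'
    rw [mem_union, mem_union, mem_filter, mem_range, mem_filter, mem_range, mem_filter]
    by_cases h7 : q < 7
    · exact Or.inl (Or.inr ⟨h7, hq'.2⟩)
    · by_cases hM : q ∣ M
      · exact Or.inr ⟨hq, hM⟩
      · exact Or.inl (Or.inl ⟨hq'.1, hq'.2, by omega, hM⟩)
  have h3 : #((range 7).filter fun q : ℕ => q.Prime) = 3 := by decide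
  have hω : #((Nat.primesLE z).filter (fun q => q ∣ M)) ≤ #M.primeFactors := by
    refine card_le_card fun q hq => ?_
    rw [mem_filter, Nat.primesLE_eq_filter_range, mem_filter] at hq
    exact Nat.mem_primeFactors.mpr ⟨hq.1.2, hq.2, hM0⟩
  calc Nat.primeCounting z = #(Nat.primesLE z) := (Nat.primesLE_card_eq_primeCounting z).symm
    _ ≤ #(((range (z + 1)).filter fun q : ℕ => q.Prime ∧ 7 ≤ q ∧ ¬q ∣ M)
          ∪ (range 7).filter (fun q : ℕ => q.Prime))
          + #((Nat.primesLE z).filter (fun q : ℕ => q ∣ M)) :=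
        (card_le_card hsub).trans (card_union_le _ _)
    _ ≤ #((range (z + 1)).filter fun q : ℕ => q.Prime ∧ 7 ≤ q ∧ ¬q ∣ M)
          + #((range 7).filter fun q : ℕ => q.Prime)
          + #((Nat.primesLE z).filter (fun q : ℕ => q ∣ M)) := by gcongr; exact card_union_le _ _
    _ ≤ _ := by rw [h3]; gcongr

/-- The product of the good primes `q ≤ z` is at most `4^z` (`primorial_le_four_pow`). -/
theorem prod_goodPrimes_le_four_pow (M z : ℕ) :
    ∏ q ∈ (range (z + 1)).filter (fun q : ℕ => q.Prime ∧ 7 ≤ q ∧ ¬q ∣ M), q ≤ 4 ^ z := by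
  calc ∏ q ∈ (range (z + 1)).filter (fun q : ℕ => q.Prime ∧ 7 ≤ q ∧ ¬q ∣ M), q
      ≤ ∏ q ∈ (range (z + 1)).filter (fun q : ℕ => q.Prime), q := by
        refine Finset.prod_le_prod_of_subset_of_one_le' (fun q hq => ?_) (fun q hq _ => ?_)
        · rw [mem_filter] at hq ⊢
          exact ⟨hq.1, hq.2.1⟩
        · exact (mem_filter.mp hq).2.one_lt.le
    _ = primorial z := rfl
    _ ≤ 4 ^ z := primorial_le_four_pow z

end Summit.Parity.BatemanHorn.Theorems
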